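import Summits.BirchSwinnertonDyer.BirchSwinnertonDyer.Theorems.ThetaPartnerAtTwoSignedTransportAtTwoSharpInvariantFamilies
import Summits.BirchSwinnertonDyer.BirchSwinnertonDyer.Theorems.ThetaPartnerAtTwoSignedTransportAtTwoSurjEngine
import HarnessLib

/-!
# SURJ♯ at `2` in Greenberg's `𝒫`-currency with the «`I_Γ = 0`» input (COINV♯) taken as a HYPOTHESIS — width seat w2's engine run
# `sharp_localRes_surjective_of_print4` re-parameterised on (CASSELS, COINV♯) instead of the four printed Greenberg facts
# (the K1P re-pointing, part 2)

Route `ThetaPartnerAtTwo` (TP2) / `ResidualThetaTransportAtTwo` (RTT), PUB binder `PublishedInputsGreenbergControlAtTwo`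
(stmt-BirchSwinnertonDyer-24143) as consumed by the closed K1P door `SignedTransportAtTwo.signedTransportAtTwo_rankZero_of_print4`
through K1's `stub_surj2`. Seat `bsd-inputs-r1-p1` (D-0154 (2) INPUTS row 1; `--supports` 24143).

WHY. In w2's proof of SURJ♯ (`…SharpSurjOfPrint`, GV Prop. (2.1) READ AT `2`, signed, no layer-wise Poitou–Tate) the facts
Prop. 4.12 / the corank count / weak Leopoldt enter at exactly ONE point: the «`I_Γ = 0`» input of the engine
`SurjEngine.le_of_fixed_le_of_le_sub_image_of_torsion`, i.e. COINV♯ `(Sel♯_{S₀}(E/ℚ_∞))_Γ = 0`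
(`sharp_forall_exists_conjH1_sub_eq_of_print4`); the `T`-fixed families need only CASSELS (`exists_mem_sharp_localRes_eq_of_invariant`).
THIS FILE re-runs that proof VERBATIM with COINV♯ as the hypothesis `hcoinvS` (and `γ` any element — the topological-generator
property is only used by the suppliers of `hcoinvS`), so that ANY supplier of COINV♯ gives SURJ♯: the printed one (w2), or the
«hres road» `sharp_forall_exists_conjH1_sub_eq_of_cassels_of_resTwo` of part 1 (`…SharpCoinvOfResTwo`: CASSELS + `res²` injective).

* `sharp_localRes_surjective_of_cassels_of_coinv` — `W/ℚ` globally minimal, `GoodSS W 2`, `a₂(W) = 0`, `κ` cyclotomic, `γ ∈ Γ_ℚ`,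
  `S₀` a finite set of ODD places containing the bad ones, `Sel_{2^∞}(W/ℚ)` finite, CASSELS by name, COINV♯ for `(S₀, γ)`;
  local data `N_v = 2^{s_v}`, `g_v` with `γ^{N_v} ∈ Gal(ℚ̄/ℚ_∞)·g_v|`, `hgper`, `hginv` as in w2's statement. THEN every family
  `(c_{v,n})_{v ∈ S₀, n < N_v}` of `2`-power-torsion classes `c_{v,n} ∈ 𝒫_v = H¹(Gal(ℚ̄_v/(ℚ_∞)_η), E(ℚ̄_v))` is
  `(loc_v(conj_{γⁿ} c))` for one `c ∈ Sel♯_{S₀}(E/ℚ_∞)`.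

HONEST FRAMING: THEOREMS ONLY (no definition, no named fact, no `sorry`); the proof body is w2's (`prover-bsd-wall-tp2-p3-w2` g3,
`…SharpSurjOfPrint`) with one `have` replaced by the hypothesis — credited there; CASSELS and COINV♯ are displayed hypotheses; closes
no item; BSD is not proved by any of this.

References: [GreenbergVatsal2000] §2 Prop. (2.1), Cor. (2.3), p. 23; [GreenbergLNM1716] §4 pp. 104, 107–109, Prop. 4.13 / p. 122;
[Washington1997] §13.2.
-/

set_option autoImplicit false
-- the Theorems namespace of this sub repeats the summit name by design (D-0017 nested layout)
set_option linter.dupNamespace false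

noncomputable section

open scoped Classical NumberField

open NumberField IsDedekindDomain

namespace Summit.BirchSwinnertonDyer.BirchSwinnertonDyer.Theorems.SignedEC

open Literature.NumberTheory.EllipticCurves Literature.NumberTheory.GaloisRepresentations
  WeierstrassCurve ZpExtension Literature.NumberTheory.EllipticCurves.Kobayashi2003
  Literature.NumberTheory.EllipticCurves.IwasawaDual Literature.NumberTheory.EllipticCurves.IwasawaAlgebra
  Literature.NumberTheory.EllipticCurves.GreenbergVatsal2000 Literature.NumberTheory.EllipticCurves.Rank1Residual
  Literature.NumberTheory.EllipticCurves.Sprung2012 Summit.BirchSwinnertonDyer.Rank1Residual.Additive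

variable (W : WeierstrassCurve ℚ) [W.IsElliptic] [W.IsGloballyMinimal]

/-! ## SURJ♯ in the `𝒫`-currency from CASSELS and COINV♯ -/

/-- **SURJ♯ at `2` (GV Prop. (2.1) signed, READ AT `2`, `𝒫`-currency) from CASSELS, `Sel_{2^∞}(E/ℚ)` finite and COINV♯ as a
hypothesis** — see the module docstring for the statement; `hgper`/`hginv` encode «`N_v` is exactly the number of places of `ℚ_∞`
above `v`» through the chosen local generator `g_v`; `hcoinvS` is «`(Sel♯_{S₀})_Γ = 0`» for the element `γ`. Proof body = w2's
`sharp_localRes_surjective_of_print4` with the COINV♯ step supplied by `hcoinvS`. [cite: GreenbergVatsal2000, §2 Prop. (2.1) (p. 23)]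
[cite: GreenbergLNM1716, §4 pp. 104, 107–109, Prop. 4.13 / p. 122] -/
theorem sharp_localRes_surjective_of_cassels_of_coinv (hC : Greenberg1999.casselsSurjectivity_H1Sigma ℚ)
    (hss : GoodSS W 2) (ha : W.frobeniusTrace 2 = 0) {κ : ZpExtension ℚ 2} (hκ : κ.IsCyclotomic)
    (γ : Field.absoluteGaloisGroup ℚ)
    (S₀ : Finset (HeightOneSpectrum (𝓞 ℚ))) (hS₀ : ∀ v ∈ S₀, ((2 : ℕ) : 𝓞 ℚ) ∉ v.asIdeal)
    (hS : ∀ v : HeightOneSpectrum (𝓞 ℚ), ¬ W.HasGoodReductionAt v → v ∈ S₀) (hSel : Finite (W.selmerGroupPInfty 2))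
    (hcoinvS : ∀ s ∈ unramifiedOutside κ.kerSubgroup ↥(W.geomPrimaryTorsion 2) 2 (↑S₀ : Set (HeightOneSpectrum (𝓞 ℚ))) ⊓
        ⨅ (v : HeightOneSpectrum (𝓞 ℚ)) (_ : ((2 : ℕ) : 𝓞 ℚ) ∈ v.asIdeal) (σ : Field.absoluteGaloisGroup ℚ),
          (localKummerOverOfEmb W 2 κ.kerSubgroup (closureEmb (K := ℚ) (v.adicCompletion ℚ))
            (⨆ n : ℕ, signedLocalPoints κ (v.adicCompletion ℚ) W 1 n)).comap (W.conjH1 2 κ.kerSubgroup σ),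
      ∃ s' ∈ unramifiedOutside κ.kerSubgroup ↥(W.geomPrimaryTorsion 2) 2 (↑S₀ : Set (HeightOneSpectrum (𝓞 ℚ))) ⊓
        ⨅ (v : HeightOneSpectrum (𝓞 ℚ)) (_ : ((2 : ℕ) : 𝓞 ℚ) ∈ v.asIdeal) (σ : Field.absoluteGaloisGroup ℚ),
          (localKummerOverOfEmb W 2 κ.kerSubgroup (closureEmb (K := ℚ) (v.adicCompletion ℚ))
            (⨆ n : ℕ, signedLocalPoints κ (v.adicCompletion ℚ) W 1 n)).comap (W.conjH1 2 κ.kerSubgroup σ),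
        W.conjH1 2 κ.kerSubgroup γ s' - s' = s)
    (N : HeightOneSpectrum (𝓞 ℚ) → ℕ) (hN : ∀ v ∈ S₀, ∃ s : ℕ, N v = 2 ^ s)
    (g : ∀ v : HeightOneSpectrum (𝓞 ℚ), Field.absoluteGaloisGroup (v.adicCompletion ℚ))
    (hg : ∀ v ∈ S₀, ∃ h ∈ κ.kerSubgroup, γ ^ N v = h * resGal (K := ℚ) (v.adicCompletion ℚ) (g v))
    (hgper : ∀ v ∈ S₀, ∀ c : discreteH1 (localSubgroup κ.kerSubgroup (v.adicCompletion ℚ)) (localPoints W (v.adicCompletion ℚ)),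
      (∃ k : ℕ, 2 ^ k • c = 0) → ∃ j : ℕ,
        Literature.NumberTheory.EllipticCurves.conjH1 (localSubgroup κ.kerSubgroup (v.adicCompletion ℚ))
          (localPoints W (v.adicCompletion ℚ)) (g v ^ 2 ^ j) c = c)
    (hginv : ∀ v ∈ S₀, ∀ c : discreteH1 (localSubgroup κ.kerSubgroup (v.adicCompletion ℚ)) (localPoints W (v.adicCompletion ℚ)),
      (∃ k : ℕ, 2 ^ k • c = 0) →
      Literature.NumberTheory.EllipticCurves.conjH1 (localSubgroup κ.kerSubgroup (v.adicCompletion ℚ))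
          (localPoints W (v.adicCompletion ℚ)) (g v) c = c →
      ∀ δ : Field.absoluteGaloisGroup (v.adicCompletion ℚ),
        Literature.NumberTheory.EllipticCurves.conjH1 (localSubgroup κ.kerSubgroup (v.adicCompletion ℚ))
          (localPoints W (v.adicCompletion ℚ)) δ c = c)
    (y : ∀ v : HeightOneSpectrum (𝓞 ℚ), ℕ →
      discreteH1 (localSubgroup κ.kerSubgroup (v.adicCompletion ℚ)) (localPoints W (v.adicCompletion ℚ)))
    (hy : ∀ v ∈ S₀, ∀ n < N v, ∃ k : ℕ, 2 ^ k • y v n = 0) :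
    ∃ c ∈ unramifiedOutside κ.kerSubgroup ↥(W.geomPrimaryTorsion 2) 2 (↑S₀ : Set (HeightOneSpectrum (𝓞 ℚ))) ⊓
        ⨅ (v : HeightOneSpectrum (𝓞 ℚ)) (_ : ((2 : ℕ) : 𝓞 ℚ) ∈ v.asIdeal) (σ : Field.absoluteGaloisGroup ℚ),
          (localKummerOverOfEmb W 2 κ.kerSubgroup (closureEmb (K := ℚ) (v.adicCompletion ℚ))
            (⨆ n : ℕ, signedLocalPoints κ (v.adicCompletion ℚ) W 1 n)).comap (W.conjH1 2 κ.kerSubgroup σ),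
      ∀ v ∈ S₀, ∀ n < N v,
        W.localResOver 2 κ.kerSubgroup (v.adicCompletion ℚ) (W.conjH1 2 κ.kerSubgroup (γ ^ n) c) = y v n := by
  -- NOTATION
  set Ssharp := unramifiedOutside κ.kerSubgroup ↥(W.geomPrimaryTorsion 2) 2 (↑S₀ : Set (HeightOneSpectrum (𝓞 ℚ))) ⊓
        ⨅ (v : HeightOneSpectrum (𝓞 ℚ)) (_ : ((2 : ℕ) : 𝓞 ℚ) ∈ v.asIdeal) (σ : Field.absoluteGaloisGroup ℚ),
          (localKummerOverOfEmb W 2 κ.kerSubgroup (closureEmb (K := ℚ) (v.adicCompletion ℚ))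
            (⨆ n : ℕ, signedLocalPoints κ (v.adicCompletion ℚ) W 1 n)).comap (W.conjH1 2 κ.kerSubgroup σ) with hSsharp
  -- the local class groups `𝒫_v`, the local twists `Tloc v = conj_{g_v}`
  let P : HeightOneSpectrum (𝓞 ℚ) → Type := fun v ↦
    discreteH1 (localSubgroup κ.kerSubgroup (v.adicCompletion ℚ)) (localPoints W (v.adicCompletion ℚ))
  let Tloc : ∀ v : HeightOneSpectrum (𝓞 ℚ), P v →+ P v := fun v ↦
    Literature.NumberTheory.EllipticCurves.conjH1 (localSubgroup κ.kerSubgroup (v.adicCompletion ℚ))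
      (localPoints W (v.adicCompletion ℚ)) (g v)
  have hTloc_pow : ∀ (v : HeightOneSpectrum (𝓞 ℚ)) (m : ℕ) (c : P v), (Tloc v)^[m] c =
      Literature.NumberTheory.EllipticCurves.conjH1 (localSubgroup κ.kerSubgroup (v.adicCompletion ℚ))
        (localPoints W (v.adicCompletion ℚ)) (g v ^ m) c := by
    intro v m
    induction m with
    | zero =>
      intro c
      rw [Function.iterate_zero, id, pow_zero, Literature.NumberTheory.EllipticCurves.conjH1_one_holds,
        AddMonoidHom.id_apply]
    | succ m ih =>
      intro c
      rw [Function.iterate_succ_apply', ih, pow_succ',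
        Literature.NumberTheory.EllipticCurves.conjH1_mul_holds, AddMonoidHom.comp_apply]
  -- the ambient group of families and the shift
  let F : Type := ∀ v : ↥S₀, ℕ → P v.1
  let τ : F →+ F :=
    { toFun := fun f v n ↦ f v (n + 1)
      map_zero' := rfl
      map_add' := fun _ _ ↦ rfl }
  let T : Module.End ℤ F := τ.toIntLinearMap
  have hT : ∀ (f : F) (v : ↥S₀) (n : ℕ), T f v n = f v (n + 1) := fun _ _ _ ↦ rfl
  have hTpow : ∀ (m : ℕ) (f : F) (v : ↥S₀) (n : ℕ), (T ^ m) f v n = f v (n + m) := by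
    intro m
    induction m with
    | zero => intro f v n; rw [pow_zero, Module.End.one_apply, add_zero]
    | succ m ih =>
      intro f v n
      rw [pow_succ, Module.End.mul_apply, ih, hT, add_assoc]
  -- the subgroup `G₀` of `g`-quasi-periodic, uniformly `2`-power-torsion families
  let G₀ : AddSubgroup F :=
    { carrier := {f | (∀ (v : ↥S₀) (n : ℕ), f v (n + N v) = Tloc v (f v n)) ∧ ∃ k : ℕ, ∀ (v : ↥S₀) (n : ℕ), 2 ^ k • f v n = 0}
      add_mem' := by
        rintro a b ⟨ha1, ka, ha2⟩ ⟨hb1, kb, hb2⟩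
        refine ⟨fun v n ↦ ?_, ka + kb, fun v n ↦ ?_⟩
        · change a v (n + N v) + b v (n + N v) = Tloc v (a v n + b v n)
          rw [map_add, ha1, hb1]
        · change 2 ^ (ka + kb) • (a v n + b v n) = 0
          rw [smul_add, pow_add, mul_comm, mul_smul, ha2, smul_zero, mul_comm, mul_smul, hb2, smul_zero, add_zero]
      zero_mem' := ⟨fun v n ↦ by change (0 : P v) = Tloc v 0; rw [map_zero], 0, fun v n ↦ smul_zero _⟩
      neg_mem' := by
        rintro a ⟨ha1, ka, ha2⟩
        refine ⟨fun v n ↦ ?_, ka, fun v n ↦ ?_⟩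
        · change -a v (n + N v) = Tloc v (-a v n)
          rw [map_neg, ha1]
        · change 2 ^ ka • (-a v n) = 0
          rw [smul_neg, ha2, neg_zero] }
  have hG₀ : ∀ f : F, f ∈ G₀ ↔
      (∀ (v : ↥S₀) (n : ℕ), f v (n + N v) = Tloc v (f v n)) ∧ ∃ k : ℕ, ∀ (v : ↥S₀) (n : ℕ), 2 ^ k • f v n = 0 :=
    fun f ↦ Iff.rfl
  -- quasi-periodicity iterated
  have hqp : ∀ f ∈ G₀, ∀ (v : ↥S₀) (q r : ℕ), f v (r + N v * q) = (Tloc v)^[q] (f v r) := by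
    intro f hf v q
    induction q with
    | zero => intro r; rw [mul_zero, add_zero, Function.iterate_zero, id]
    | succ q ih =>
      intro r
      rw [Nat.mul_succ, ← add_assoc, ((hG₀ f).mp hf).1, ih, Function.iterate_succ_apply']
  -- the detecting map `Φ : c ↦ (loc_v conj_{γⁿ} c)`
  let Φ : W.subgroupH1 2 κ.kerSubgroup →+ F :=
    { toFun := fun c v n ↦ W.localResOver 2 κ.kerSubgroup (v.1.adicCompletion ℚ) (W.conjH1 2 κ.kerSubgroup (γ ^ n) c)
      map_zero' := by funext v n; simp only [map_zero]; rfl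
      map_add' := fun a b ↦ by funext v n; simp only [map_add]; rfl }
  have hΦ : ∀ c (v : ↥S₀) n, Φ c v n =
      W.localResOver 2 κ.kerSubgroup (v.1.adicCompletion ℚ) (W.conjH1 2 κ.kerSubgroup (γ ^ n) c) := fun _ _ _ ↦ rfl
  -- `Φ (conj_γ c) = T (Φ c)`
  have hΦconj : ∀ c, Φ (W.conjH1 2 κ.kerSubgroup γ c) = T (Φ c) := by
    intro c
    funext v n
    change W.localResOver 2 κ.kerSubgroup (v.1.adicCompletion ℚ)
        (W.conjH1 2 κ.kerSubgroup (γ ^ n) (W.conjH1 2 κ.kerSubgroup γ c)) =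
      W.localResOver 2 κ.kerSubgroup (v.1.adicCompletion ℚ) (W.conjH1 2 κ.kerSubgroup (γ ^ (n + 1)) c)
    rw [pow_succ, W.conjH1_mul_holds 2 κ.kerSubgroup, AddMonoidHom.comp_apply]
  -- `Φ c` is quasi-periodic: `conj_{γ^{N_v}} = conj_{h·g_v|} ` and localisation is `D_v`-equivariant
  have hΦqp : ∀ c (v : ↥S₀) (n : ℕ), Φ c v (n + N v) = Tloc v (Φ c v n) := by
    intro c v n
    obtain ⟨h, hh, hgv⟩ := hg v.1 v.2
    rw [hΦ, hΦ, pow_add, W.conjH1_mul_holds 2 κ.kerSubgroup, AddMonoidHom.comp_apply]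
    -- `conj_{γⁿ}` and `conj_{γ^N}` commute
    have hcomm : W.conjH1 2 κ.kerSubgroup (γ ^ n) (W.conjH1 2 κ.kerSubgroup (γ ^ N v) c) =
        W.conjH1 2 κ.kerSubgroup (γ ^ N v) (W.conjH1 2 κ.kerSubgroup (γ ^ n) c) := by
      rw [← AddMonoidHom.comp_apply, ← W.conjH1_mul_holds 2 κ.kerSubgroup, ← pow_add, add_comm, pow_add,
        W.conjH1_mul_holds 2 κ.kerSubgroup, AddMonoidHom.comp_apply]
    rw [hcomm, hgv, W.conjH1_mul_holds 2 κ.kerSubgroup, AddMonoidHom.comp_apply, W.conjH1_of_mem_holds 2 κ.kerSubgroup hh,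
      AddMonoidHom.id_apply, WeierstrassCurve.localResOver_conjH1_resGal]
  -- the image `I` of `Sel♯_{S₀}` and `I ≤ G₀`
  let I : AddSubgroup F := Ssharp.map Φ
  have hI : ∀ f : F, f ∈ I ↔ ∃ c ∈ Ssharp, Φ c = f := fun f ↦ AddSubgroup.mem_map
  have hIG : I ≤ G₀ := by
    intro f hf
    obtain ⟨c, hc, rfl⟩ := (hI f).mp hf
    refine (hG₀ _).mpr ⟨fun v n ↦ hΦqp c v n, ?_⟩
    obtain ⟨k, hk⟩ := W.exists_pow_smul_subgroupH1_ker_eq_zero κ c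
    refine ⟨k, fun v n ↦ ?_⟩
    rw [hΦ, ← map_nsmul, ← map_nsmul, hk, map_zero, map_zero]
  -- `T` preserves `G₀`
  have hTG : ∀ f ∈ G₀, T f ∈ G₀ := by
    intro f hf
    obtain ⟨h1, k, h2⟩ := (hG₀ f).mp hf
    refine (hG₀ _).mpr ⟨fun v n ↦ ?_, k, fun v n ↦ ?_⟩
    · rw [hT, hT, add_right_comm, h1]
    · rw [hT]; exact h2 v (n + 1)
  -- every `f ∈ G₀` is fixed by some `T^{2^K}`
  have hper : ∀ f ∈ G₀, ∃ K : ℕ, (T ^ 2 ^ K) f = f := by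
    intro f hf
    obtain ⟨h1, k, h2⟩ := (hG₀ f).mp hf
    -- a uniform exponent `J` with `conj_{g_v^{2^J}}` fixing `f v n`, `n < N v`
    obtain ⟨J, hJ⟩ := exists_uniform_nat (ι := ↥S₀) (fun v ↦ N v)
      (fun v n j ↦ Literature.NumberTheory.EllipticCurves.conjH1 (localSubgroup κ.kerSubgroup (v.1.adicCompletion ℚ))
        (localPoints W (v.1.adicCompletion ℚ)) (g v ^ 2 ^ j) (f v n) = f v n)
      (fun v n j j' hjj' hfix ↦ by
        have e : g v.1 ^ 2 ^ j' = (g v.1 ^ 2 ^ j) ^ 2 ^ (j' - j) := by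
          rw [← pow_mul, ← pow_add, Nat.add_sub_cancel' hjj']
        rw [e]
        exact conjH1_pow_eq_self _ _ hfix _)
      (fun v n _ ↦ hgper v.1 v.2 (f v n) ⟨k, h2 v n⟩)
    -- exponents of the `N v`
    have hs : ∀ v : ↥S₀, ∃ s : ℕ, N v = 2 ^ s := fun v ↦ hN v.1 v.2
    obtain ⟨S, hS'⟩ := exists_uniform_nat (ι := ↥S₀) (fun _ ↦ 1) (fun v _ s ↦ N v ∣ 2 ^ s)
      (fun v n s s' hss' hd ↦ hd.trans (pow_dvd_pow 2 hss')) (fun v n _ ↦ by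
        obtain ⟨s, hs⟩ := hs v; exact ⟨s, by rw [hs]⟩)
    refine ⟨S + J, ?_⟩
    funext v n
    rw [hTpow]
    obtain ⟨m, hm⟩ := hS' v 0 Nat.one_pos
    -- `f v` has period `N v * 2^J`
    have hperiod : ∀ r : ℕ, f v (r + N v * 2 ^ J) = f v r := by
      intro r
      -- write `r = r₀ + N v * q` with `r₀ < N v`
      have hNpos : 0 < N v := by obtain ⟨s, hs⟩ := hs v; rw [hs]; positivity
      have hr : r = r % N v + N v * (r / N v) := (Nat.mod_add_div r (N v)).symm
      rw [hr, add_assoc, ← mul_add, hqp f hf, hqp f hf, Function.iterate_add_apply, hTloc_pow v (2 ^ J)]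
      · congr 1
        exact hJ v (r % N v) (Nat.mod_lt r hNpos)
    have e : 2 ^ (S + J) = N v * 2 ^ J * (2 ^ S / N v) := by
      rw [pow_add, hm, Nat.mul_div_cancel_left _ (by obtain ⟨s, hs⟩ := hs v; rw [hs]; positivity)]
      ring
    rw [e]
    -- iterate the period
    have hmult : ∀ q r : ℕ, f v (r + N v * 2 ^ J * q) = f v r := by
      intro q
      induction q with
      | zero => intro r; rw [mul_zero, add_zero]
      | succ q ih => intro r; rw [Nat.mul_succ, ← add_assoc, hperiod, ih]
    exact hmult _ _
  -- uniform torsion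
  have htor : ∀ f ∈ G₀, ∃ j : ℕ, 2 ^ j • f = 0 := by
    intro f hf
    obtain ⟨-, k, h2⟩ := (hG₀ f).mp hf
    exact ⟨k, funext fun v ↦ funext fun n ↦ h2 v n⟩
  -- `I_Γ = 0`: COINV♯
  have hcoinv : ∀ i ∈ I, ∃ j ∈ I, T j - j = i := by
    intro i hi
    obtain ⟨s, hs, rfl⟩ := (hI i).mp hi
    obtain ⟨s', hs', hss'⟩ := hcoinvS s hs
    refine ⟨Φ s', (hI _).mpr ⟨s', hs', rfl⟩, ?_⟩
    rw [← hΦconj, ← map_sub, hss']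
  -- the `T`-fixed families come from `ℚ` (§2's `exists_mem_sharp_localRes_eq_of_invariant`)
  have hfix : ∀ f ∈ G₀, T f = f → f ∈ I := by
    intro f hf hTf
    obtain ⟨h1, k, h2⟩ := (hG₀ f).mp hf
    -- `f v` is constant
    have hconst : ∀ (v : ↥S₀) (n : ℕ), f v n = f v 0 := by
      intro v n
      induction n with
      | zero => rfl
      | succ n ih =>
        have e := congrArg (fun F' : F ↦ F' v n) hTf
        rw [hT] at e
        rw [e, ih]
    -- the constant value is `Γ_{ℚ_v}`-invariant
    have hinv : ∀ (v : ↥S₀) (δ : Field.absoluteGaloisGroup (v.1.adicCompletion ℚ)),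
        Literature.NumberTheory.EllipticCurves.conjH1 (localSubgroup κ.kerSubgroup (v.1.adicCompletion ℚ))
          (localPoints W (v.1.adicCompletion ℚ)) δ (f v 0) = f v 0 := fun v ↦
      hginv v.1 v.2 (f v 0) ⟨k, h2 v 0⟩ (by
        have e := h1 v 0
        rw [zero_add, hconst v (N v)] at e
        exact e.symm)
    obtain ⟨c, hcS, hc⟩ := exists_mem_sharp_localRes_eq_of_invariant W hC hss ha hκ γ S₀ hS₀ hS hSel (fun v ↦ f v 0)
      (fun v ↦ ⟨k, h2 v 0⟩) hinv
    refine (hI f).mpr ⟨c, hcS, ?_⟩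
    funext v n
    rw [hΦ, hc v n, hconst v n]
  -- THE ENGINE: `G₀ ≤ I`
  have hGI : G₀ ≤ I :=
    SurjEngine.le_of_fixed_le_of_le_sub_image_of_torsion 2 T I G₀ hIG hTG hper htor hfix hcoinv
  -- the target family, extended `g`-quasi-periodically
  obtain ⟨k₀, hk₀⟩ := exists_uniform_nat (ι := ↥S₀) (fun v ↦ N v) (fun v n k ↦ 2 ^ k • y v.1 n = 0)
    (fun v n k k' hkk' hk ↦ by
      rw [← Nat.add_sub_cancel' hkk', pow_add, mul_comm, mul_smul, hk, smul_zero])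
    (fun v n hn ↦ hy v.1 v.2 n hn)
  have hNpos : ∀ v : ↥S₀, 0 < N v := fun v ↦ by obtain ⟨s, hs⟩ := hN v.1 v.2; rw [hs]; positivity
  have hfdata : ∃ f : F, ∀ v n, f v n = (Tloc v)^[n / N v] (y v.1 (n % N v)) := ⟨_, fun _ _ ↦ rfl⟩
  obtain ⟨f, hf⟩ := hfdata
  have hfG : f ∈ G₀ := by
    refine (hG₀ f).mpr ⟨fun v n ↦ ?_, k₀, fun v n ↦ ?_⟩
    · rw [hf, hf, Nat.add_div_right _ (hNpos v), Nat.add_mod_right, Function.iterate_succ_apply']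
    · rw [hf, hTloc_pow, ← map_nsmul, hk₀ v (n % N v) (Nat.mod_lt _ (hNpos v)), map_zero]
  obtain ⟨c, hc, hcf⟩ := (hI f).mp (hGI hfG)
  refine ⟨c, hc, fun v hv n hn ↦ ?_⟩
  have e := congrArg (fun F' : F ↦ F' ⟨v, hv⟩ n) hcf
  rw [hΦ, hf, Nat.div_eq_of_lt hn, Nat.mod_eq_of_lt hn, Function.iterate_zero, id] at e
  exact e

end Summit.BirchSwinnertonDyer.BirchSwinnertonDyer.Theorems.SignedEC

end
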